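import Literature.NumberTheory.Sieve.HeathBrownCubicTypeIIOffDiag
import HarnessLib

/-!
# Heath-Brown's Lemma 3.10, §12 p. 72: the forms `p_i(β₁, β₂)`, `q_i(β₁, β₂)` and `S₄ = 2 S₄⁺`

Support for the proof of **Lemma 3.10** of D. R. Heath-Brown, *Primes represented by `x³ + 2y³`*,
Acta Math. 186 (2001), §12 p. 72 and p. 74:

> "Since `αβ_i = x_i + y_i2^{1/3}` we see from (11.4) that `x_i` and `y_i` may be expressed in terms of
> `β₁` and `β₂` as `(x_i, y_i) = ±D⁻¹(p_i(β₁, β₂), q_i(β₁, β₂))`, `i = 1, 2`, say. It then follows that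
> `S₄ = ∑ F_{β₁}F_{β₂} ∑_± W(±D⁻¹p₁(β₁,β₂)) W(±D⁻¹p₂(β₁,β₂))`. Since `p₁(β₁, β₂) = −p₂(β₂, β₁)`, our
> expression for `S₄` may be reduced to `S₄ = 2 ∑ F_{β₁}F_{β₂} W(D⁻¹p₁(β₁,β₂)) W(D⁻¹p₂(β₁,β₂))`. …
> The remaining constraints may be written in the form `(β₁, β₂) ∈ ℛ_D`, where `ℛ_D ⊆ ℝ⁶` is defined by
> the inequalities `V < |N(β_i)| ≤ 2V`, `N(β_i)^{1/3}ε₀^{−1/2} < β_i ≤ N(β_i)^{1/3}ε₀^{1/2}` and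
> `XD < p_i(β₁,β₂), q_i(β₁,β₂) ≤ XD(1+η)`." (p. 72) "… `q₁(β₁,β₂) = ±D(v₁r + u₁s + 2w₁t)`, with
> `(r, s, t)` given by (11.4). … `∂F/∂x₄ = x₂² − x₁x₃`, `∂F/∂x₅ = 2x₃² − x₁x₂`, `∂F/∂x₆ = x₁² − 2x₂x₃` …
> `x₁³ + 2x₂³ + 4x₃³ − 6x₁x₂x₃ = x₁ ∂F/∂x₆ + 2x₂ ∂F/∂x₄ + 2x₃ ∂F/∂x₅`" (p. 74).

All PROVED, in the coordinates of the tree (`β̂ = (u, v, w)`, `v = β̂₁ ∧ β̂₂ = cross3`, `α̂ = rev(v)/D`):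

* the "adjugate" quadratics `adjA = u² − 2vw`, `adjB = 2w² − uv`, `adjC = v² − uw` with
  **`adj_identity`**: `u·adjA + 2w·adjB + 2v·adjC = N(β̂)` (the displayed identity of p. 74), and the
  vectors `gradP = (adjB, adjA, 2 adjC)`, `gradQ = (adjC, adjB, adjA)`;
* the forms `p1Z, q1Z, p2Z, q2Z` (the first two coordinates of `rev(v)·β̂_i`) and their **structure**:
  `p₁ = gradP(β̂₁)·β̂₂`, `q₁ = −gradQ(β̂₁)·β̂₂`, `p₂ = −gradP(β̂₂)·β̂₁`, `q₂ = gradQ(β̂₂)·β̂₁`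
  (linear in the other variable; `p₂(β₁,β₂) = −p₁(β₂,β₁)`), `imulVec_rev_cross3_left/right`;
* the gradient lower bound **`abs_normForm_le_five_mul`**: `|N(β̂)| ≤ 5|β̂|_∞ max(|adjA|,|adjB|,|adjC|)`
  (real version), the "non-singularity" `|∇F| ≫ N²` of p. 74;
* real extensions `adjAR`, …, `p1R`, …, with cast lemmas and Lipschitz bounds (`abs_adjR_sub_le`,
  `abs_pR_sub_le`: `|Δp| ≤ 54M²δ`, `abs_ell_sub_le`: `|Δ ell| ≤ 4δ`);
* `aplus bb = rev(v/D)`, `RDplus` (the inequalities `XD < p_i, q_i ≤ XD(1+η)`),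
  **`Wplus_iff_RDplus`** (`W(D⁻¹p₁)W(D⁻¹p₂)` as inequalities), `S4plus` and **`S4sum_eq_two_mul_S4plus`**
  (`S₄ = 2S₄⁺`, by `p₁(β₁,β₂) = −p₂(β₂,β₁)`), and `Dhcf_le_of_Wplus` (`D ≤ 270 V/X`, (11.7)).

## References

* D. R. Heath-Brown, *Primes represented by `x³ + 2y³`*, Acta Math. 186 (2001), §12 pp. 72–74.
  [cite: HeathBrownActa2001, §12 p. 72]

## Mathlib / tree search

Tree: `HeathBrownCubicTypeIIOffDiag` (`rev`, `hcf3`, `divVec`, `Dhcf`, `nAB`, `S4sum`,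
`exists_sign_smul_rev_eq`, `support_of_Fb_ne_zero`), `HeathBrownCubicTypeIICauchy` (`Wab`, `boxVec`,
`Abox`, `Fb`), `HeathBrownCubicWindow` (`mulVec`, `abs_coord_alpha_le`, `exists_abs_coord_alpha_ge`,
`ell`), `HeathBrownCubicLatticeGeometry` (`supZ`, `dot3`).
-/

noncomputable section

open Finset NumberField

namespace Literature.NumberTheory.Sieve.CubicSieve

open LFunctions.CubeRootTwoField CubicPrimes

/-! ### The adjugate quadratics and the forms `p_i`, `q_i` -/

/-- `adjA(u,v,w) = u² − 2vw` (`= ∂F/∂x₆` of p. 74). [cite: HeathBrownActa2001, §12 p. 74] -/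
def adjA (b : ℤ × ℤ × ℤ) : ℤ := b.1 ^ 2 - 2 * b.2.1 * b.2.2

/-- `adjB(u,v,w) = 2w² − uv` (`= ∂F/∂x₅`). [cite: HeathBrownActa2001, §12 p. 74] -/
def adjB (b : ℤ × ℤ × ℤ) : ℤ := 2 * b.2.2 ^ 2 - b.1 * b.2.1

/-- `adjC(u,v,w) = v² − uw` (`= ∂F/∂x₄`). [cite: HeathBrownActa2001, §12 p. 74] -/
def adjC (b : ℤ × ℤ × ℤ) : ℤ := b.2.1 ^ 2 - b.1 * b.2.2

/-- **`u·adjA + 2w·adjB + 2v·adjC = u³ + 2v³ + 4w³ − 6uvw = N(β̂)`** (p. 74). [cite: HeathBrownActa2001, §12 p. 74] -/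
theorem adj_identity (b : ℤ × ℤ × ℤ) :
    b.1 * adjA b + 2 * b.2.2 * adjB b + 2 * b.2.1 * adjC b =
      b.1 ^ 3 + 2 * b.2.1 ^ 3 + 4 * b.2.2 ^ 3 - 6 * b.1 * b.2.1 * b.2.2 := by
  simp only [adjA, adjB, adjC]; ring

/-- `∇_{β̂₂} p₁ = (adjB, adjA, 2adjC)(β̂₁)`. [cite: HeathBrownActa2001, §12 p. 74] -/
def gradP (b : ℤ × ℤ × ℤ) : ℤ × ℤ × ℤ := (adjB b, adjA b, 2 * adjC b)

/-- `−∇_{β̂₂} q₁ = (adjC, adjB, adjA)(β̂₁)`. [cite: HeathBrownActa2001, §12 p. 74] -/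
def gradQ (b : ℤ × ℤ × ℤ) : ℤ × ℤ × ℤ := (adjC b, adjB b, adjA b)

/-- `p₁(β₁, β₂)`: the first coordinate of `rev(β̂₁ ∧ β̂₂) · β̂₁` (`= ±D x₁`). [cite: HeathBrownActa2001, §12 p. 72] -/
def p1Z (b₁ b₂ : ℤ × ℤ × ℤ) : ℤ := (imulVec (rev (cross3 b₁ b₂)) b₁).1

/-- `q₁(β₁, β₂)`: the second coordinate of `rev(β̂₁ ∧ β̂₂) · β̂₁` (`= ±D y₁`). [cite: HeathBrownActa2001, §12 p. 72] -/
def q1Z (b₁ b₂ : ℤ × ℤ × ℤ) : ℤ := (imulVec (rev (cross3 b₁ b₂)) b₁).2.1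

/-- `p₂(β₁, β₂)`: the first coordinate of `rev(β̂₁ ∧ β̂₂) · β̂₂`. [cite: HeathBrownActa2001, §12 p. 72] -/
def p2Z (b₁ b₂ : ℤ × ℤ × ℤ) : ℤ := (imulVec (rev (cross3 b₁ b₂)) b₂).1

/-- `q₂(β₁, β₂)`: the second coordinate of `rev(β̂₁ ∧ β̂₂) · β̂₂`. [cite: HeathBrownActa2001, §12 p. 72] -/
def q2Z (b₁ b₂ : ℤ × ℤ × ℤ) : ℤ := (imulVec (rev (cross3 b₁ b₂)) b₂).2.1

/-- **`p₁ = gradP(β̂₁) · β̂₂`** (linear in `β̂₂`). [cite: HeathBrownActa2001, §12 p. 74] -/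
theorem p1Z_eq (b₁ b₂ : ℤ × ℤ × ℤ) : p1Z b₁ b₂ = dot3 (gradP b₁) b₂ := by
  simp only [p1Z, imulVec, rev, cross3, dot3, gradP, adjA, adjB, adjC]; ring

/-- **`q₁ = −gradQ(β̂₁) · β̂₂`**. [cite: HeathBrownActa2001, §12 p. 74] -/
theorem q1Z_eq (b₁ b₂ : ℤ × ℤ × ℤ) : q1Z b₁ b₂ = -dot3 (gradQ b₁) b₂ := by
  simp only [q1Z, imulVec, rev, cross3, dot3, gradQ, adjA, adjB, adjC]; ring

/-- **`p₂ = −gradP(β̂₂) · β̂₁`** ("`p₁(β₁, β₂) = −p₂(β₂, β₁)`"). [cite: HeathBrownActa2001, §12 p. 72] -/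
theorem p2Z_eq (b₁ b₂ : ℤ × ℤ × ℤ) : p2Z b₁ b₂ = -dot3 (gradP b₂) b₁ := by
  simp only [p2Z, imulVec, rev, cross3, dot3, gradP, adjA, adjB, adjC]; ring

/-- **`q₂ = gradQ(β̂₂) · β̂₁`**. [cite: HeathBrownActa2001, §12 p. 72] -/
theorem q2Z_eq (b₁ b₂ : ℤ × ℤ × ℤ) : q2Z b₁ b₂ = dot3 (gradQ b₂) b₁ := by
  simp only [q2Z, imulVec, rev, cross3, dot3, gradQ, adjA, adjB, adjC]; ring

/-- `rev(β̂₁ ∧ β̂₂) · β̂₁ = (p₁, q₁, 0)` (third coordinate `0`: `rev(v)` is orthogonal to `β̂₁`). [cite: HeathBrownActa2001, §11 p. 69] -/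
theorem imulVec_rev_cross3_left (b₁ b₂ : ℤ × ℤ × ℤ) :
    imulVec (rev (cross3 b₁ b₂)) b₁ = (p1Z b₁ b₂, q1Z b₁ b₂, 0) := by
  refine Prod.ext rfl (Prod.ext rfl ?_)
  simp only [imulVec, rev, cross3]; ring

/-- `rev(β̂₁ ∧ β̂₂) · β̂₂ = (p₂, q₂, 0)`. [cite: HeathBrownActa2001, §11 p. 69] -/
theorem imulVec_rev_cross3_right (b₁ b₂ : ℤ × ℤ × ℤ) :
    imulVec (rev (cross3 b₁ b₂)) b₂ = (p2Z b₁ b₂, q2Z b₁ b₂, 0) := by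
  refine Prod.ext rfl (Prod.ext rfl ?_)
  simp only [imulVec, rev, cross3]; ring

/-- `imulVec (μ • a) b = μ • imulVec a b`. [folklore] -/
theorem imulVec_smul_left (μ : ℤ) (a b : ℤ × ℤ × ℤ) : imulVec (μ • a) b = μ • imulVec a b := by
  ext <;> simp [imulVec] <;> ring

/-! ### Real extensions and Lipschitz bounds -/

/-- Real `adjA`. [cite: HeathBrownActa2001, §12 p. 74] -/
def adjAR (b : ℝ × ℝ × ℝ) : ℝ := b.1 ^ 2 - 2 * b.2.1 * b.2.2
/-- Real `adjB`. [cite: HeathBrownActa2001, §12 p. 74] -/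
def adjBR (b : ℝ × ℝ × ℝ) : ℝ := 2 * b.2.2 ^ 2 - b.1 * b.2.1
/-- Real `adjC`. [cite: HeathBrownActa2001, §12 p. 74] -/
def adjCR (b : ℝ × ℝ × ℝ) : ℝ := b.2.1 ^ 2 - b.1 * b.2.2

/-- Real dot product on `ℝ³`. [folklore] -/
def dotR (a b : ℝ × ℝ × ℝ) : ℝ := a.1 * b.1 + a.2.1 * b.2.1 + a.2.2 * b.2.2

/-- Real `gradP`. [cite: HeathBrownActa2001, §12 p. 74] -/
def gradPR (b : ℝ × ℝ × ℝ) : ℝ × ℝ × ℝ := (adjBR b, adjAR b, 2 * adjCR b)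
/-- Real `gradQ`. [cite: HeathBrownActa2001, §12 p. 74] -/
def gradQR (b : ℝ × ℝ × ℝ) : ℝ × ℝ × ℝ := (adjCR b, adjBR b, adjAR b)

/-- Real `p₁ = gradP(β₁)·β₂`. [cite: HeathBrownActa2001, §12 p. 72] -/
def p1R (b₁ b₂ : ℝ × ℝ × ℝ) : ℝ := dotR (gradPR b₁) b₂
/-- Real `q₁ = −gradQ(β₁)·β₂`. [cite: HeathBrownActa2001, §12 p. 72] -/
def q1R (b₁ b₂ : ℝ × ℝ × ℝ) : ℝ := -dotR (gradQR b₁) b₂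
/-- Real `p₂ = −gradP(β₂)·β₁`. [cite: HeathBrownActa2001, §12 p. 72] -/
def p2R (b₁ b₂ : ℝ × ℝ × ℝ) : ℝ := -dotR (gradPR b₂) b₁
/-- Real `q₂ = gradQ(β₂)·β₁`. [cite: HeathBrownActa2001, §12 p. 72] -/
def q2R (b₁ b₂ : ℝ × ℝ × ℝ) : ℝ := dotR (gradQR b₂) b₁

/-- The real identity `u·adjA + 2w·adjB + 2v·adjC = N`. [cite: HeathBrownActa2001, §12 p. 74] -/
theorem adjR_identity (b : ℝ × ℝ × ℝ) :
    b.1 * adjAR b + 2 * b.2.2 * adjBR b + 2 * b.2.1 * adjCR b = normForm b := by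
  simp only [adjAR, adjBR, adjCR, normForm]; ring

/-- Cast lemmas for the forms. [folklore] -/
theorem p1R_castVec (b₁ b₂ : ℤ × ℤ × ℤ) : p1R (castVec b₁) (castVec b₂) = (p1Z b₁ b₂ : ℝ) := by
  rw [p1Z_eq]; simp only [p1R, dotR, gradPR, adjAR, adjBR, adjCR, dot3, gradP, adjA, adjB, adjC, castVec]; push_cast; ring

/-- Cast lemma for `q₁`. [folklore] -/
theorem q1R_castVec (b₁ b₂ : ℤ × ℤ × ℤ) : q1R (castVec b₁) (castVec b₂) = (q1Z b₁ b₂ : ℝ) := by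
  rw [q1Z_eq]; simp only [q1R, dotR, gradQR, adjAR, adjBR, adjCR, dot3, gradQ, adjA, adjB, adjC, castVec]; push_cast; ring

/-- Cast lemma for `p₂`. [folklore] -/
theorem p2R_castVec (b₁ b₂ : ℤ × ℤ × ℤ) : p2R (castVec b₁) (castVec b₂) = (p2Z b₁ b₂ : ℝ) := by
  rw [p2Z_eq]; simp only [p2R, dotR, gradPR, adjAR, adjBR, adjCR, dot3, gradP, adjA, adjB, adjC, castVec]; push_cast; ring

/-- Cast lemma for `q₂`. [folklore] -/
theorem q2R_castVec (b₁ b₂ : ℤ × ℤ × ℤ) : q2R (castVec b₁) (castVec b₂) = (q2Z b₁ b₂ : ℝ) := by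
  rw [q2Z_eq]; simp only [q2R, dotR, gradQR, adjAR, adjBR, adjCR, dot3, gradQ, adjA, adjB, adjC, castVec]; push_cast; ring

/-- **The gradient lower bound** ("`|∇F(𝐧)| ≫ N²`", p. 74): `|N(β̂)| ≤ 5 M · max(|adjA|, |adjB|, |adjC|)`
when `|β̂_i| ≤ M`. [cite: HeathBrownActa2001, §12 p. 74] -/
theorem abs_normForm_le_five_mul {b : ℝ × ℝ × ℝ} {M : ℝ} (h1 : |b.1| ≤ M) (h2 : |b.2.1| ≤ M)
    (h3 : |b.2.2| ≤ M) :
    |normForm b| ≤ 5 * M * max |adjAR b| (max |adjBR b| |adjCR b|) := by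
  set G := max |adjAR b| (max |adjBR b| |adjCR b|) with hG
  have hA : |adjAR b| ≤ G := le_max_left _ _
  have hB : |adjBR b| ≤ G := (le_max_left _ _).trans (le_max_right _ _)
  have hC : |adjCR b| ≤ G := (le_max_right _ _).trans (le_max_right _ _)
  have hM : 0 ≤ M := (abs_nonneg _).trans h1
  have hG0 : 0 ≤ G := (abs_nonneg _).trans hA
  rw [← adjR_identity]
  calc |b.1 * adjAR b + 2 * b.2.2 * adjBR b + 2 * b.2.1 * adjCR b|
      ≤ |b.1 * adjAR b| + |2 * b.2.2 * adjBR b| + |2 * b.2.1 * adjCR b| := abs_add_three _ _ _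
    _ = |b.1| * |adjAR b| + 2 * |b.2.2| * |adjBR b| + 2 * |b.2.1| * |adjCR b| := by
        simp only [abs_mul, abs_two]
    _ ≤ M * G + 2 * M * G + 2 * M * G := by
        gcongr
    _ = 5 * M * G := by ring

/-- Sup-norm entries of `gradPR`, `gradQR` dominate `max(|adjA|, |adjB|, |adjC|)`. [folklore] -/
theorem max_adj_le_sup_gradPR (b : ℝ × ℝ × ℝ) :
    max |adjAR b| (max |adjBR b| |adjCR b|) ≤ max |(gradPR b).1| (max |(gradPR b).2.1| |(gradPR b).2.2|) := by
  simp only [gradPR]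
  have hC : |adjCR b| ≤ |2 * adjCR b| := by
    rw [abs_mul, abs_two]; linarith [abs_nonneg (adjCR b)]
  refine max_le ?_ (max_le ?_ ?_)
  · exact (le_max_left _ _).trans (le_max_right _ _)
  · exact le_max_left _ _
  · exact hC.trans ((le_max_right _ _).trans (le_max_right _ _))

/-- The same for `gradQR`. [folklore] -/
theorem max_adj_le_sup_gradQR (b : ℝ × ℝ × ℝ) :
    max |adjAR b| (max |adjBR b| |adjCR b|) ≤ max |(gradQR b).1| (max |(gradQR b).2.1| |(gradQR b).2.2|) := by
  simp only [gradQR]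
  refine max_le ?_ (max_le ?_ ?_)
  · exact (le_max_right _ _).trans (le_max_right _ _)
  · exact (le_max_left _ _).trans (le_max_right _ _)
  · exact le_max_left _ _

/-- Products: `|st − s't'| ≤ 2Mδ`. [folklore] -/
theorem abs_mul_sub_mul_le {s t s' t' M δ : ℝ} (hs : |s| ≤ M) (ht' : |t'| ≤ M)
    (hds : |s - s'| ≤ δ) (hdt : |t - t'| ≤ δ) : |s * t - s' * t'| ≤ 2 * M * δ := by
  have hM : 0 ≤ M := (abs_nonneg _).trans hs
  have hδ : 0 ≤ δ := (abs_nonneg _).trans hds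
  have e : s * t - s' * t' = s * (t - t') + (s - s') * t' := by ring
  rw [e]
  calc |s * (t - t') + (s - s') * t'| ≤ |s * (t - t')| + |(s - s') * t'| := abs_add_le _ _
    _ = |s| * |t - t'| + |s - s'| * |t'| := by rw [abs_mul, abs_mul]
    _ ≤ M * δ + δ * M := add_le_add (mul_le_mul hs hdt (abs_nonneg _) hM) (mul_le_mul hds ht' (abs_nonneg _) hδ)
    _ = 2 * M * δ := by ring

/-- Bounds `|adj_*| ≤ 3M²` and Lipschitz `|Δ adj_*| ≤ 6Mδ` for the three quadratics. [folklore] -/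
theorem adjR_bounds {b b' : ℝ × ℝ × ℝ} {M δ : ℝ}
    (hb : |b.1| ≤ M ∧ |b.2.1| ≤ M ∧ |b.2.2| ≤ M) (hb' : |b'.1| ≤ M ∧ |b'.2.1| ≤ M ∧ |b'.2.2| ≤ M)
    (hd : |b.1 - b'.1| ≤ δ ∧ |b.2.1 - b'.2.1| ≤ δ ∧ |b.2.2 - b'.2.2| ≤ δ) :
    (|adjAR b| ≤ 3 * M ^ 2 ∧ |adjBR b| ≤ 3 * M ^ 2 ∧ |adjCR b| ≤ 3 * M ^ 2) ∧
      (|adjAR b - adjAR b'| ≤ 6 * M * δ ∧ |adjBR b - adjBR b'| ≤ 6 * M * δ ∧ |adjCR b - adjCR b'| ≤ 6 * M * δ) := by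
  obtain ⟨h1, h2, h3⟩ := hb
  obtain ⟨h1', h2', h3'⟩ := hb'
  obtain ⟨d1, d2, d3⟩ := hd
  have hM : 0 ≤ M := (abs_nonneg _).trans h1
  have hδ : 0 ≤ δ := (abs_nonneg _).trans d1
  have hP : ∀ s t : ℝ, |s| ≤ M → |t| ≤ M → |s * t| ≤ M ^ 2 := by
    intro s t hs ht; rw [abs_mul, sq]; exact mul_le_mul hs ht (abs_nonneg _) hM
  have bA : |adjAR b| ≤ 3 * M ^ 2 := by
    simp only [adjAR]
    calc |b.1 ^ 2 - 2 * b.2.1 * b.2.2| ≤ |b.1 ^ 2| + |2 * b.2.1 * b.2.2| := abs_sub _ _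
      _ = |b.1 * b.1| + 2 * |b.2.1 * b.2.2| := by rw [sq, mul_assoc, abs_mul (2:ℝ), abs_two]
      _ ≤ M ^ 2 + 2 * M ^ 2 := add_le_add (hP _ _ h1 h1) (by linarith [hP _ _ h2 h3])
      _ = 3 * M ^ 2 := by ring
  have bB : |adjBR b| ≤ 3 * M ^ 2 := by
    simp only [adjBR]
    calc |2 * b.2.2 ^ 2 - b.1 * b.2.1| ≤ |2 * b.2.2 ^ 2| + |b.1 * b.2.1| := abs_sub _ _
      _ = 2 * |b.2.2 * b.2.2| + |b.1 * b.2.1| := by rw [sq, abs_mul (2:ℝ), abs_two]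
      _ ≤ 2 * M ^ 2 + M ^ 2 := add_le_add (by linarith [hP _ _ h3 h3]) (hP _ _ h1 h2)
      _ = 3 * M ^ 2 := by ring
  have bC : |adjCR b| ≤ 3 * M ^ 2 := by
    simp only [adjCR]
    calc |b.2.1 ^ 2 - b.1 * b.2.2| ≤ |b.2.1 ^ 2| + |b.1 * b.2.2| := abs_sub _ _
      _ = |b.2.1 * b.2.1| + |b.1 * b.2.2| := by rw [sq]
      _ ≤ M ^ 2 + M ^ 2 := add_le_add (hP _ _ h2 h2) (hP _ _ h1 h3)
      _ ≤ 3 * M ^ 2 := by nlinarith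
  have dA : |adjAR b - adjAR b'| ≤ 6 * M * δ := by
    simp only [adjAR]
    have e : b.1 ^ 2 - 2 * b.2.1 * b.2.2 - (b'.1 ^ 2 - 2 * b'.2.1 * b'.2.2) =
        (b.1 * b.1 - b'.1 * b'.1) - 2 * (b.2.1 * b.2.2 - b'.2.1 * b'.2.2) := by ring
    rw [e]
    calc |(b.1 * b.1 - b'.1 * b'.1) - 2 * (b.2.1 * b.2.2 - b'.2.1 * b'.2.2)|
        ≤ |b.1 * b.1 - b'.1 * b'.1| + |2 * (b.2.1 * b.2.2 - b'.2.1 * b'.2.2)| := abs_sub _ _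
      _ = |b.1 * b.1 - b'.1 * b'.1| + 2 * |b.2.1 * b.2.2 - b'.2.1 * b'.2.2| := by rw [abs_mul (2:ℝ), abs_two]
      _ ≤ 2 * M * δ + 2 * (2 * M * δ) :=
          add_le_add (abs_mul_sub_mul_le h1 h1' d1 d1) (by linarith [abs_mul_sub_mul_le h2 h3' d2 d3])
      _ = 6 * M * δ := by ring
  have dB : |adjBR b - adjBR b'| ≤ 6 * M * δ := by
    simp only [adjBR]
    have e : 2 * b.2.2 ^ 2 - b.1 * b.2.1 - (2 * b'.2.2 ^ 2 - b'.1 * b'.2.1) =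
        2 * (b.2.2 * b.2.2 - b'.2.2 * b'.2.2) - (b.1 * b.2.1 - b'.1 * b'.2.1) := by ring
    rw [e]
    calc |2 * (b.2.2 * b.2.2 - b'.2.2 * b'.2.2) - (b.1 * b.2.1 - b'.1 * b'.2.1)|
        ≤ |2 * (b.2.2 * b.2.2 - b'.2.2 * b'.2.2)| + |b.1 * b.2.1 - b'.1 * b'.2.1| := abs_sub _ _
      _ = 2 * |b.2.2 * b.2.2 - b'.2.2 * b'.2.2| + |b.1 * b.2.1 - b'.1 * b'.2.1| := by rw [abs_mul (2:ℝ), abs_two]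
      _ ≤ 2 * (2 * M * δ) + 2 * M * δ :=
          add_le_add (by linarith [abs_mul_sub_mul_le h3 h3' d3 d3]) (abs_mul_sub_mul_le h1 h2' d1 d2)
      _ = 6 * M * δ := by ring
  have dC : |adjCR b - adjCR b'| ≤ 6 * M * δ := by
    simp only [adjCR]
    have e : b.2.1 ^ 2 - b.1 * b.2.2 - (b'.2.1 ^ 2 - b'.1 * b'.2.2) =
        (b.2.1 * b.2.1 - b'.2.1 * b'.2.1) - (b.1 * b.2.2 - b'.1 * b'.2.2) := by ring
    rw [e]
    calc |(b.2.1 * b.2.1 - b'.2.1 * b'.2.1) - (b.1 * b.2.2 - b'.1 * b'.2.2)|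
        ≤ |b.2.1 * b.2.1 - b'.2.1 * b'.2.1| + |b.1 * b.2.2 - b'.1 * b'.2.2| := abs_sub _ _
      _ ≤ 2 * M * δ + 2 * M * δ := add_le_add (abs_mul_sub_mul_le h2 h2' d2 d2) (abs_mul_sub_mul_le h1 h3' d1 d3)
      _ ≤ 6 * M * δ := by nlinarith
  exact ⟨⟨bA, bB, bC⟩, dA, dB, dC⟩

/-- Lipschitz for a dot product `g·x`: `|g·x − g'·x'| ≤ 3(G δ + M γ)` for `|g_i| ≤ G`, `|x'_i| ≤ M`,
`|Δg_i| ≤ γ`, `|Δx_i| ≤ δ`. [folklore] -/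
theorem abs_dotR_sub_le {g g' x x' : ℝ × ℝ × ℝ} {G M γ δ : ℝ}
    (hg : |g.1| ≤ G ∧ |g.2.1| ≤ G ∧ |g.2.2| ≤ G) (hx' : |x'.1| ≤ M ∧ |x'.2.1| ≤ M ∧ |x'.2.2| ≤ M)
    (hdg : |g.1 - g'.1| ≤ γ ∧ |g.2.1 - g'.2.1| ≤ γ ∧ |g.2.2 - g'.2.2| ≤ γ)
    (hdx : |x.1 - x'.1| ≤ δ ∧ |x.2.1 - x'.2.1| ≤ δ ∧ |x.2.2 - x'.2.2| ≤ δ) :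
    |dotR g x - dotR g' x'| ≤ 3 * (G * δ + γ * M) := by
  obtain ⟨g1, g2, g3⟩ := hg; obtain ⟨x1, x2, x3⟩ := hx'
  obtain ⟨dg1, dg2, dg3⟩ := hdg; obtain ⟨dx1, dx2, dx3⟩ := hdx
  have hG : 0 ≤ G := (abs_nonneg _).trans g1
  have hM : 0 ≤ M := (abs_nonneg _).trans x1
  have hγ : 0 ≤ γ := (abs_nonneg _).trans dg1
  have hδ : 0 ≤ δ := (abs_nonneg _).trans dx1
  have key : ∀ (a a' y y' : ℝ), |a| ≤ G → |y'| ≤ M → |a - a'| ≤ γ → |y - y'| ≤ δ →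
      |a * y - a' * y'| ≤ G * δ + γ * M := by
    intro a a' y y' ha hy hda hdy
    have e : a * y - a' * y' = a * (y - y') + (a - a') * y' := by ring
    rw [e]
    calc |a * (y - y') + (a - a') * y'| ≤ |a * (y - y')| + |(a - a') * y'| := abs_add_le _ _
      _ = |a| * |y - y'| + |a - a'| * |y'| := by rw [abs_mul, abs_mul]
      _ ≤ G * δ + γ * M := add_le_add (mul_le_mul ha hdy (abs_nonneg _) hG) (mul_le_mul hda hy (abs_nonneg _) hγ)
  have e : dotR g x - dotR g' x' = (g.1 * x.1 - g'.1 * x'.1) + (g.2.1 * x.2.1 - g'.2.1 * x'.2.1) +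
      (g.2.2 * x.2.2 - g'.2.2 * x'.2.2) := by simp only [dotR]; ring
  rw [e]
  calc |(g.1 * x.1 - g'.1 * x'.1) + (g.2.1 * x.2.1 - g'.2.1 * x'.2.1) + (g.2.2 * x.2.2 - g'.2.2 * x'.2.2)|
      ≤ |g.1 * x.1 - g'.1 * x'.1| + |g.2.1 * x.2.1 - g'.2.1 * x'.2.1| + |g.2.2 * x.2.2 - g'.2.2 * x'.2.2| :=
        abs_add_three _ _ _
    _ ≤ (G * δ + γ * M) + (G * δ + γ * M) + (G * δ + γ * M) :=
        add_le_add (add_le_add (key _ _ _ _ g1 x1 dg1 dx1) (key _ _ _ _ g2 x2 dg2 dx2)) (key _ _ _ _ g3 x3 dg3 dx3)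
    _ = 3 * (G * δ + γ * M) := by ring

/-- **Lipschitz bounds for the four forms**: `|Δp₁|, |Δq₁|, |Δp₂|, |Δq₂| ≤ 48M²δ` when all twelve
coordinates are `≤ M` and differ by `≤ δ` (the first-order part of "`F(v₁+δ, u) = F(v₁, u) + δ∂F/∂x₁ + O(Rδ²)`"). [cite: HeathBrownActa2001, Lemma 4.9] -/
theorem abs_pR_sub_le {b₁ b₂ b₁' b₂' : ℝ × ℝ × ℝ} {M δ : ℝ}
    (h₁ : |b₁.1| ≤ M ∧ |b₁.2.1| ≤ M ∧ |b₁.2.2| ≤ M) (h₂ : |b₂.1| ≤ M ∧ |b₂.2.1| ≤ M ∧ |b₂.2.2| ≤ M)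
    (h₁' : |b₁'.1| ≤ M ∧ |b₁'.2.1| ≤ M ∧ |b₁'.2.2| ≤ M) (h₂' : |b₂'.1| ≤ M ∧ |b₂'.2.1| ≤ M ∧ |b₂'.2.2| ≤ M)
    (d₁ : |b₁.1 - b₁'.1| ≤ δ ∧ |b₁.2.1 - b₁'.2.1| ≤ δ ∧ |b₁.2.2 - b₁'.2.2| ≤ δ)
    (d₂ : |b₂.1 - b₂'.1| ≤ δ ∧ |b₂.2.1 - b₂'.2.1| ≤ δ ∧ |b₂.2.2 - b₂'.2.2| ≤ δ) :
    |p1R b₁ b₂ - p1R b₁' b₂'| ≤ 54 * M ^ 2 * δ ∧ |q1R b₁ b₂ - q1R b₁' b₂'| ≤ 54 * M ^ 2 * δ ∧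
      |p2R b₁ b₂ - p2R b₁' b₂'| ≤ 54 * M ^ 2 * δ ∧ |q2R b₁ b₂ - q2R b₁' b₂'| ≤ 54 * M ^ 2 * δ := by
  have hM : 0 ≤ M := (abs_nonneg _).trans h₁.1
  have hδ : 0 ≤ δ := (abs_nonneg _).trans d₁.1
  obtain ⟨⟨bA1, bB1, bC1⟩, dA1, dB1, dC1⟩ := adjR_bounds h₁ h₁' d₁
  obtain ⟨⟨bA2, bB2, bC2⟩, dA2, dB2, dC2⟩ := adjR_bounds h₂ h₂' d₂
  have b2C1 : |2 * adjCR b₁| ≤ 6 * M ^ 2 := by rw [abs_mul, abs_two]; linarith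
  have b2C2 : |2 * adjCR b₂| ≤ 6 * M ^ 2 := by rw [abs_mul, abs_two]; linarith
  have d2C1 : |2 * adjCR b₁ - 2 * adjCR b₁'| ≤ 12 * M * δ := by rw [← mul_sub, abs_mul, abs_two]; linarith
  have d2C2 : |2 * adjCR b₂ - 2 * adjCR b₂'| ≤ 12 * M * δ := by rw [← mul_sub, abs_mul, abs_two]; linarith
  have w1 : 3 * M ^ 2 ≤ 6 * M ^ 2 := by nlinarith
  have w2 : 6 * M * δ ≤ 12 * M * δ := by nlinarith
  have gP1 : |(gradPR b₁).1| ≤ 6 * M ^ 2 ∧ |(gradPR b₁).2.1| ≤ 6 * M ^ 2 ∧ |(gradPR b₁).2.2| ≤ 6 * M ^ 2 :=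
    ⟨bB1.trans w1, bA1.trans w1, b2C1⟩
  have gP2 : |(gradPR b₂).1| ≤ 6 * M ^ 2 ∧ |(gradPR b₂).2.1| ≤ 6 * M ^ 2 ∧ |(gradPR b₂).2.2| ≤ 6 * M ^ 2 :=
    ⟨bB2.trans w1, bA2.trans w1, b2C2⟩
  have gQ1 : |(gradQR b₁).1| ≤ 6 * M ^ 2 ∧ |(gradQR b₁).2.1| ≤ 6 * M ^ 2 ∧ |(gradQR b₁).2.2| ≤ 6 * M ^ 2 :=
    ⟨bC1.trans w1, bB1.trans w1, bA1.trans w1⟩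
  have gQ2 : |(gradQR b₂).1| ≤ 6 * M ^ 2 ∧ |(gradQR b₂).2.1| ≤ 6 * M ^ 2 ∧ |(gradQR b₂).2.2| ≤ 6 * M ^ 2 :=
    ⟨bC2.trans w1, bB2.trans w1, bA2.trans w1⟩
  have dgP1 : |(gradPR b₁).1 - (gradPR b₁').1| ≤ 12 * M * δ ∧ |(gradPR b₁).2.1 - (gradPR b₁').2.1| ≤ 12 * M * δ ∧
      |(gradPR b₁).2.2 - (gradPR b₁').2.2| ≤ 12 * M * δ := ⟨dB1.trans w2, dA1.trans w2, d2C1⟩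
  have dgP2 : |(gradPR b₂).1 - (gradPR b₂').1| ≤ 12 * M * δ ∧ |(gradPR b₂).2.1 - (gradPR b₂').2.1| ≤ 12 * M * δ ∧
      |(gradPR b₂).2.2 - (gradPR b₂').2.2| ≤ 12 * M * δ := ⟨dB2.trans w2, dA2.trans w2, d2C2⟩
  have dgQ1 : |(gradQR b₁).1 - (gradQR b₁').1| ≤ 12 * M * δ ∧ |(gradQR b₁).2.1 - (gradQR b₁').2.1| ≤ 12 * M * δ ∧
      |(gradQR b₁).2.2 - (gradQR b₁').2.2| ≤ 12 * M * δ := ⟨dC1.trans w2, dB1.trans w2, dA1.trans w2⟩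
  have dgQ2 : |(gradQR b₂).1 - (gradQR b₂').1| ≤ 12 * M * δ ∧ |(gradQR b₂).2.1 - (gradQR b₂').2.1| ≤ 12 * M * δ ∧
      |(gradQR b₂).2.2 - (gradQR b₂').2.2| ≤ 12 * M * δ := ⟨dC2.trans w2, dB2.trans w2, dA2.trans w2⟩
  have hle : 3 * (6 * M ^ 2 * δ + 12 * M * δ * M) ≤ 54 * M ^ 2 * δ := le_of_eq (by ring)
  refine ⟨?_, ?_, ?_, ?_⟩
  · have := abs_dotR_sub_le gP1 h₂' dgP1 d₂
    simp only [p1R]; exact this.trans hle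
  · have := abs_dotR_sub_le gQ1 h₂' dgQ1 d₂
    simp only [q1R]
    rw [show -dotR (gradQR b₁) b₂ - -dotR (gradQR b₁') b₂' = -(dotR (gradQR b₁) b₂ - dotR (gradQR b₁') b₂') by ring,
      abs_neg]
    exact this.trans hle
  · have := abs_dotR_sub_le gP2 h₁' dgP2 d₁
    simp only [p2R]
    rw [show -dotR (gradPR b₂) b₁ - -dotR (gradPR b₂') b₁' = -(dotR (gradPR b₂) b₁ - dotR (gradPR b₂') b₁') by ring,
      abs_neg]
    exact this.trans hle
  · have := abs_dotR_sub_le gQ2 h₁' dgQ2 d₁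
    simp only [q2R]; exact this.trans hle

/-! ### `α̂ = rev(v/D)` and the inequalities `XD < p_i, q_i ≤ XD(1+η)` -/

/-- **`α̂⁺ = rev((β̂₁ ∧ β̂₂)/D)`**, the `+` sign of (11.4). [cite: HeathBrownActa2001, §11 (11.4)] -/
def aplus (bb : (ℤ × ℤ × ℤ) × (ℤ × ℤ × ℤ)) : ℤ × ℤ × ℤ := rev (divVec (cross3 bb.1 bb.2) (Dhcf bb : ℤ))

/-- `D · α̂⁺ = rev(β̂₁ ∧ β̂₂)`. [cite: HeathBrownActa2001, §11 (11.4)] -/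
theorem smul_aplus (bb : (ℤ × ℤ × ℤ) × (ℤ × ℤ × ℤ)) : (Dhcf bb : ℤ) • aplus bb = rev (cross3 bb.1 bb.2) := by
  rw [aplus, ← rev_smul, Dhcf, smul_divVec (hcf3_dvd _)]

/-- `α̂⁺` is primitive (for `β̂₁ ∧ β̂₂ ≠ 0`). [folklore] -/
theorem isPrimitiveVec_aplus {bb : (ℤ × ℤ × ℤ) × (ℤ × ℤ × ℤ)} (hv : cross3 bb.1 bb.2 ≠ 0) :
    IsPrimitiveVec (aplus bb) :=
  isPrimitiveVec_rev (isPrimitiveVec_divVec_hcf3 hv)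

/-- `α̂⁺(β₂, β₁) = −α̂⁺(β₁, β₂)`. [folklore] -/
theorem aplus_swap (bb : (ℤ × ℤ × ℤ) × (ℤ × ℤ × ℤ)) : aplus bb.swap = -aplus bb := by
  rw [aplus, aplus, Dhcf_swap, Prod.fst_swap, Prod.snd_swap, cross3_swap, ← rev_neg]
  congr 1
  obtain ⟨h1, h2, h3⟩ := hcf3_dvd (cross3 bb.1 bb.2)
  rw [Dhcf]
  ext <;> simp only [divVec, Prod.fst_neg, Prod.snd_neg]
  · exact Int.neg_ediv_of_dvd h1
  · exact Int.neg_ediv_of_dvd h2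
  · exact Int.neg_ediv_of_dvd h3

/-- `D · (α̂⁺ β̂₁) = (p₁, q₁, 0)` and `D · (α̂⁺ β̂₂) = (p₂, q₂, 0)`. [cite: HeathBrownActa2001, §12 p. 72] -/
theorem smul_imulVec_aplus (bb : (ℤ × ℤ × ℤ) × (ℤ × ℤ × ℤ)) :
    (Dhcf bb : ℤ) • imulVec (aplus bb) bb.1 = (p1Z bb.1 bb.2, q1Z bb.1 bb.2, 0) ∧
      (Dhcf bb : ℤ) • imulVec (aplus bb) bb.2 = (p2Z bb.1 bb.2, q2Z bb.1 bb.2, 0) := by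
  rw [← imulVec_smul_left, ← imulVec_smul_left, smul_aplus]
  exact ⟨imulVec_rev_cross3_left _ _, imulVec_rev_cross3_right _ _⟩

/-- **The inequalities defining `ℛ_D`** for the pair (the part coupling `β₁` and `β₂`):
`XD < p_i(β₁,β₂), q_i(β₁,β₂) ≤ XD(1+η)`, `i = 1, 2`, `D = h.c.f.(β̂₁ ∧ β̂₂)`. [cite: HeathBrownActa2001, §12 p. 72] -/
def RDplus (X η : ℝ) (bb : (ℤ × ℤ × ℤ) × (ℤ × ℤ × ℤ)) : Prop :=
  (X * Dhcf bb < p1Z bb.1 bb.2 ∧ (p1Z bb.1 bb.2 : ℝ) ≤ X * (1 + η) * Dhcf bb) ∧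
  (X * Dhcf bb < q1Z bb.1 bb.2 ∧ (q1Z bb.1 bb.2 : ℝ) ≤ X * (1 + η) * Dhcf bb) ∧
  (X * Dhcf bb < p2Z bb.1 bb.2 ∧ (p2Z bb.1 bb.2 : ℝ) ≤ X * (1 + η) * Dhcf bb) ∧
  (X * Dhcf bb < q2Z bb.1 bb.2 ∧ (q2Z bb.1 bb.2 : ℝ) ≤ X * (1 + η) * Dhcf bb)

/-- `W(a β̂)` for an integer vector `P = a β̂` with `D • P = (p, q, 0)`, `D > 0`, as inequalities. [folklore] -/
theorem Wab_iff_of_smul_eq {X η : ℝ} (hX : 0 ≤ X) {a b : ℤ × ℤ × ℤ} {D : ℕ} (hD : 0 < D) {p q : ℤ}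
    (h : (D : ℤ) • imulVec a b = (p, q, 0)) :
    Wab X η a b ↔ (X * D < p ∧ (p : ℝ) ≤ X * (1 + η) * D) ∧ (X * D < q ∧ (q : ℝ) ≤ X * (1 + η) * D) := by
  have hDR : (0 : ℝ) < D := by exact_mod_cast hD
  set P := imulVec a b with hP
  have e1 : (D : ℤ) * P.1 = p := by have := congrArg Prod.fst h; simpa using this
  have e2 : (D : ℤ) * P.2.1 = q := by have := congrArg (fun x => x.2.1) h; simpa using this
  have e3 : P.2.2 = 0 := by
    have := congrArg (fun x => x.2.2) h
    simp only [Prod.smul_snd, smul_eq_mul] at this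
    rcases mul_eq_zero.mp this with h0 | h0
    · exact absurd h0 (by exact_mod_cast hD.ne')
    · exact h0
  have e1R : (p : ℝ) = D * P.1 := by exact_mod_cast e1.symm
  have e2R : (q : ℝ) = D * P.2.1 := by exact_mod_cast e2.symm
  rw [Wab, mem_boxVec_iff]
  constructor
  · rintro ⟨xy, hxy, hv⟩
    rw [mem_box_iff] at hxy
    obtain ⟨a1, a2, a3, a4⟩ := hxy
    have hx : (xy.1 : ℤ) = P.1 := by have := congrArg Prod.fst hv; simpa using this
    have hy : (xy.2 : ℤ) = P.2.1 := by have := congrArg (fun x => x.2.1) hv; simpa using this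
    have hxR : (xy.1 : ℝ) = ((P.1 : ℤ) : ℝ) := by exact_mod_cast hx
    have hyR : (xy.2 : ℝ) = ((P.2.1 : ℤ) : ℝ) := by exact_mod_cast hy
    rw [e1R, e2R]
    rw [hxR] at a1 a2; rw [hyR] at a3 a4
    refine ⟨⟨by nlinarith, by nlinarith⟩, ⟨by nlinarith, by nlinarith⟩⟩
  · rintro ⟨⟨h1, h2⟩, ⟨h3, h4⟩⟩
    rw [e1R] at h1 h2; rw [e2R] at h3 h4
    have g1 : X < ((P.1 : ℤ) : ℝ) := by nlinarith
    have g2 : ((P.1 : ℤ) : ℝ) ≤ X * (1 + η) := by nlinarith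
    have g3 : X < ((P.2.1 : ℤ) : ℝ) := by nlinarith
    have g4 : ((P.2.1 : ℤ) : ℝ) ≤ X * (1 + η) := by nlinarith
    have hp0 : 0 ≤ P.1 := by
      have : (0 : ℝ) < P.1 := lt_of_le_of_lt hX g1
      exact_mod_cast this.le
    have hq0 : 0 ≤ P.2.1 := by
      have : (0 : ℝ) < P.2.1 := lt_of_le_of_lt hX g3
      exact_mod_cast this.le
    refine ⟨(P.1.toNat, P.2.1.toNat), ?_, ?_⟩
    · rw [mem_box_iff]
      have c1 : ((P.1.toNat : ℕ) : ℝ) = ((P.1 : ℤ) : ℝ) := by exact_mod_cast Int.toNat_of_nonneg hp0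
      have c2 : ((P.2.1.toNat : ℕ) : ℝ) = ((P.2.1 : ℤ) : ℝ) := by exact_mod_cast Int.toNat_of_nonneg hq0
      simp only
      rw [c1, c2]
      exact ⟨g1, g2, g3, g4⟩
    · simp only
      rw [Int.toNat_of_nonneg hp0, Int.toNat_of_nonneg hq0, ← e3]

/-- **`W(D⁻¹p₁)W(D⁻¹p₂)` as inequalities**: for `β̂₁ ∧ β̂₂ ≠ 0`,
`W(α̂⁺β̂₁) ∧ W(α̂⁺β̂₂) ↔ XD < p_i, q_i ≤ XD(1+η)` (`i = 1, 2`). [cite: HeathBrownActa2001, §12 p. 72] -/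
theorem Wplus_iff_RDplus {X η : ℝ} (hX : 0 ≤ X) {bb : (ℤ × ℤ × ℤ) × (ℤ × ℤ × ℤ)} (hv : cross3 bb.1 bb.2 ≠ 0) :
    (Wab X η (aplus bb) bb.1 ∧ Wab X η (aplus bb) bb.2) ↔ RDplus X η bb := by
  have hD : 0 < Dhcf bb := one_le_hcf3 hv
  obtain ⟨h1, h2⟩ := smul_imulVec_aplus bb
  rw [Wab_iff_of_smul_eq hX hD h1, Wab_iff_of_smul_eq hX hD h2, RDplus]
  tauto

/-! ### `S₄ = 2 S₄⁺` -/

section Defs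

variable (X η τ : ℝ) {k : ℕ} (m : Fin k → ℕ) (V T : ℝ)

open scoped Classical in
/-- **`S₄⁺`**: `∑_{β₁ ≠ β₂, D > Δ₀} F_{β₁}F_{β₂} W(D⁻¹p₁)W(D⁻¹p₂)` (the `+` sign of (11.4) only).
[cite: HeathBrownActa2001, §12 p. 72] -/
def S4plus (Δ₀ : ℝ) : ℝ :=
  ∑ bb ∈ ((Bbox T).offDiag).filter (fun bb => Δ₀ < (Dhcf bb : ℝ)),
    if Wab X η (aplus bb) bb.1 ∧ Wab X η (aplus bb) bb.2 then Fb X τ m V T bb.1 * Fb X τ m V T bb.2 else 0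

end Defs

variable {X η τ V T : ℝ} {k : ℕ} {m : Fin k → ℕ}

/-- `α̂ ∈ Abox` automatically, for `W(α̂β̂₁) = 1` with `F_{β₁} ≠ 0` ((11.6)). [cite: HeathBrownActa2001, §11 (11.6)] -/
theorem mem_Abox_of_Wab (hX : 0 < X) (hη1 : η ≤ 1) (hT : 0 < T) (hTV : T ^ 3 = V) {a b : ℤ × ℤ × ℤ}
    (hF : Fb X τ m V T b ≠ 0) (hW : Wab X η a b) : a ∈ Abox X T := by
  obtain ⟨hw, -, hN1, -⟩ := support_of_Fb_ne_zero hF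
  have hNb := absNorm_eq_normForm_of_inWindow hT hw
  have hell1 : T < ell (castVec b) := by have := hw.1; rwa [ellO_coordElt] at this
  have hell2 : ell (castVec b) ≤ unitE * T := by have := hw.2; rwa [ellO_coordElt] at this
  have hNf1 : V < normForm (castVec b) := by rw [← hNb]; exact hN1
  rw [Wab, mem_boxVec_iff] at hW
  obtain ⟨xy, hxy, heq⟩ := hW
  have hmulR : mulVec (castVec a) (castVec b) = ((xy.1 : ℝ), (xy.2 : ℝ), 0) := by
    rw [← castVec_imulVec, ← heq]; simp [castVec]
  rw [mem_box_iff] at hxy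
  obtain ⟨hx1, hx2, hy1, hy2⟩ := hxy
  obtain ⟨a1, a2, a3⟩ := abs_coord_alpha_le hX hT hTV hell1 hell2 hNf1 hmulR hx1 (by nlinarith) hy1 (by nlinarith)
  exact mem_cube_of_abs_le a1 a2 a3

open scoped Classical in
/-- **The number of `α̂` for a pair, resolved by sign**: for `β₁ ≠ β₂` with `F_{β₁} ≠ 0`,
`#{α̂} = [W(α̂⁺β̂₁)W(α̂⁺β̂₂)] + [W(α̂⁺(β₂,β₁)β̂₁)W(α̂⁺(β₂,β₁)β̂₂)]` (the two signs of (11.4); each `α̂`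
is primitive and lies in `Abox` automatically). [cite: HeathBrownActa2001, §12 p. 72] -/
theorem nAB_eq (hX : 0 < X) (hη1 : η ≤ 1) (hT : 0 < T) (hTV : T ^ 3 = V)
    {bb : (ℤ × ℤ × ℤ) × (ℤ × ℤ × ℤ)} (hbb : bb ∈ (Bbox T).offDiag)
    (hF₁ : Fb X τ m V T bb.1 ≠ 0) :
    (nAB X η T bb : ℝ) =
      (if Wab X η (aplus bb) bb.1 ∧ Wab X η (aplus bb) bb.2 then 1 else 0) +
        (if Wab X η (aplus bb.swap) bb.1 ∧ Wab X η (aplus bb.swap) bb.2 then 1 else 0) := by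
  classical
  obtain ⟨-, hprim₁, -, -⟩ := support_of_Fb_ne_zero hF₁
  have hne : bb.1 ≠ bb.2 := (mem_offDiag.mp hbb).2.2
  -- the cross product is nonzero as soon as some `α̂` works; otherwise both sides vanish
  set S := (Abox X T).filter (fun a => IsPrimitiveVec a ∧ Wab X η a bb.1 ∧ Wab X η a bb.2) with hS
  have hSeq : S = ({aplus bb, aplus bb.swap} : Finset (ℤ × ℤ × ℤ)).filter
      (fun a => Wab X η a bb.1 ∧ Wab X η a bb.2) := by
    ext a
    rw [hS, mem_filter, mem_filter, mem_insert, mem_singleton]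
    constructor
    · rintro ⟨-, hprim, hW1, hW2⟩
      have hv : cross3 bb.1 bb.2 ≠ 0 := cross3_ne_zero_of_Wab hX.le hη1 hprim₁ hne hW1 hW2
      obtain ⟨ε, hε, heq⟩ := exists_sign_smul_rev_eq hprim (dot3_rev_eq_zero_of_Wab hW1)
        (dot3_rev_eq_zero_of_Wab hW2) hv
      have hD0 : (Dhcf bb : ℤ) ≠ 0 := by exact_mod_cast (Nat.one_le_iff_ne_zero.mp (one_le_hcf3 hv))
      have hsm := smul_aplus bb
      refine ⟨?_, hW1, hW2⟩
      rcases hε with rfl | rfl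
      · left
        rw [one_smul] at heq
        have h2 : (Dhcf bb : ℤ) • rev a = (Dhcf bb : ℤ) • rev (aplus bb) := by
          conv_rhs => rw [← rev_smul, smul_aplus, rev_rev]
          exact heq
        have : rev a = rev (aplus bb) := smul_right_injective _ hD0 h2
        exact rev_injective this
      · right
        rw [aplus_swap]
        have h2 : (Dhcf bb : ℤ) • rev a = (Dhcf bb : ℤ) • rev (-aplus bb) := by
          conv_rhs => rw [rev_neg, smul_neg, ← rev_smul, smul_aplus, rev_rev]
          rw [neg_one_smul] at heq
          exact heq
        have : rev a = rev (-aplus bb) := smul_right_injective _ hD0 h2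
        exact rev_injective this
    · rintro ⟨ha, hW1, hW2⟩
      have hv : cross3 bb.1 bb.2 ≠ 0 := cross3_ne_zero_of_Wab hX.le hη1 hprim₁ hne hW1 hW2
      refine ⟨mem_Abox_of_Wab hX hη1 hT hTV hF₁ hW1, ?_, hW1, hW2⟩
      rcases ha with rfl | rfl
      · exact isPrimitiveVec_aplus hv
      · rw [aplus_swap]
        intro d h1 h2 h3
        exact isPrimitiveVec_aplus hv d (by simpa using h1) (by simpa using h2) (by simpa using h3)
  rw [nAB, ← hS, hSeq]
  -- the two candidates are distinct unless `v = 0`, in which case neither works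
  by_cases hv : cross3 bb.1 bb.2 = 0
  · have hnoW : ∀ a, ¬ (Wab X η a bb.1 ∧ Wab X η a bb.2) := fun a h =>
      cross3_ne_zero_of_Wab hX.le hη1 hprim₁ hne h.1 h.2 hv
    rw [if_neg (hnoW _), if_neg (hnoW _)]
    rw [filter_false_of_mem (fun a _ => hnoW a)]
    simp
  · have hdist : aplus bb ≠ aplus bb.swap := by
      rw [aplus_swap]
      intro h
      have h0 : aplus bb = 0 := by
        have : (2 : ℤ) • aplus bb = 0 := by rw [two_smul]; nth_rewrite 2 [h]; exact add_neg_cancel _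
        exact (smul_eq_zero.mp this).resolve_left two_ne_zero
      exact (isPrimitiveVec_aplus hv).ne_zero h0
    rw [filter_insert, filter_singleton]
    by_cases hW : Wab X η (aplus bb) bb.1 ∧ Wab X η (aplus bb) bb.2 <;>
      by_cases hW' : Wab X η (aplus bb.swap) bb.1 ∧ Wab X η (aplus bb.swap) bb.2
    · rw [if_pos hW, if_pos hW', if_pos hW, if_pos hW', card_insert_of_notMem (by simpa using hdist)]; norm_num
    · rw [if_pos hW, if_neg hW', if_pos hW, if_neg hW']; simp
    · rw [if_neg hW, if_pos hW', if_neg hW, if_pos hW']; simp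
    · rw [if_neg hW, if_neg hW', if_neg hW, if_neg hW']; simp

open scoped Classical in
/-- **`S₄ = 2 S₄⁺`** ("Since `p₁(β₁, β₂) = −p₂(β₂, β₁)`, our expression for `S₄` may be reduced to
`S₄ = 2∑ F_{β₁}F_{β₂} W(D⁻¹p₁(β₁,β₂)) W(D⁻¹p₂(β₁,β₂))`", p. 72). [cite: HeathBrownActa2001, §12 p. 72] -/
theorem S4sum_eq_two_mul_S4plus (hX : 0 < X) (hη1 : η ≤ 1) (hT : 0 < T) (hTV : T ^ 3 = V) (Δ₀ : ℝ) :
    S4sum X η τ m V T Δ₀ = 2 * S4plus X η τ m V T Δ₀ := by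
  classical
  set P := ((Bbox T).offDiag).filter (fun bb => Δ₀ < (Dhcf bb : ℝ)) with hP
  set g : (ℤ × ℤ × ℤ) × (ℤ × ℤ × ℤ) → ℝ := fun bb =>
    if Wab X η (aplus bb) bb.1 ∧ Wab X η (aplus bb) bb.2 then Fb X τ m V T bb.1 * Fb X τ m V T bb.2 else 0 with hg
  have hPswap : ∀ bb, bb ∈ P ↔ bb.swap ∈ P := by
    intro bb
    simp only [hP, mem_filter, mem_offDiag, Prod.fst_swap, Prod.snd_swap, Dhcf_swap]
    tauto
  -- termwise: `F₁F₂ n = g(bb) + g(swap bb)`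
  have hterm : ∀ bb ∈ P, Fb X τ m V T bb.1 * Fb X τ m V T bb.2 * nAB X η T bb = g bb + g bb.swap := by
    intro bb hbb
    rw [hP, mem_filter] at hbb
    by_cases hF : Fb X τ m V T bb.1 = 0 ∨ Fb X τ m V T bb.2 = 0
    · have h0 : Fb X τ m V T bb.1 * Fb X τ m V T bb.2 = 0 := by
        rcases hF with h | h <;> simp [h]
      simp only [hg, Prod.fst_swap, Prod.snd_swap]
      rw [h0, zero_mul, mul_comm (Fb X τ m V T bb.2), h0]
      split_ifs <;> simp
    · push Not at hF
      rw [nAB_eq hX hη1 hT hTV hbb.1 hF.1]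
      simp only [hg, Prod.fst_swap, Prod.snd_swap]
      split_ifs <;> (simp_all [mul_comm]; try ring)
  have hswap_sum : ∑ bb ∈ P, g bb.swap = ∑ bb ∈ P, g bb := by
    refine Finset.sum_nbij' Prod.swap Prod.swap (fun bb hbb => (hPswap bb).mp hbb)
      (fun bb hbb => (hPswap bb).mp hbb) (fun bb _ => Prod.swap_swap bb) (fun bb _ => Prod.swap_swap bb)
      (fun bb _ => rfl)
  rw [S4sum, S4plus, ← hP, sum_congr rfl hterm, sum_add_distrib, hswap_sum]
  ring

/-- **(11.7): `D ≤ 270 V/X`** for a pair with `F_{β₁}, F_{β₂} ≠ 0` and `W(α̂⁺β̂₁) = 1`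
(`|β̂₁ ∧ β̂₂|_∞ ≤ 2·(3T)²`, `|α̂|_∞ > X/(15T)`, `|v|_∞ = D|α̂|_∞`). [cite: HeathBrownActa2001, §11 (11.7)] -/
theorem Dhcf_le_of_Wab (hX : 0 < X) (hT : 0 < T) (hTV : T ^ 3 = V) {bb : (ℤ × ℤ × ℤ) × (ℤ × ℤ × ℤ)}
    (hbb : bb ∈ (Bbox T).offDiag) (hW1 : Wab X η (aplus bb) bb.1) :
    (Dhcf bb : ℝ) ≤ 270 * V / X := by
  obtain ⟨hb1, hb2, -⟩ := mem_offDiag.mp hbb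
  have hB1 := abs_le_of_mem_cube hb1
  have hB2 := abs_le_of_mem_cube hb2
  -- `|v|_∞ ≤ 2 · 3T · 3T`
  have hs1 : (supZ bb.1 : ℝ) ≤ 3 * T := supZ_le_of_mem_cube hb1
  have hs2 : (supZ bb.2 : ℝ) ≤ 3 * T := supZ_le_of_mem_cube hb2
  have hv18 : (supZ (cross3 bb.1 bb.2) : ℝ) ≤ 18 * T ^ 2 := by
    have h := supZ_cross3_le bb.1 bb.2
    have hR : (supZ (cross3 bb.1 bb.2) : ℝ) ≤ 2 * (supZ bb.1 : ℝ) * supZ bb.2 := by exact_mod_cast h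
    have h0 : (0 : ℝ) ≤ supZ bb.1 := by exact_mod_cast supZ_nonneg _
    have h0' : (0 : ℝ) ≤ supZ bb.2 := by exact_mod_cast supZ_nonneg _
    calc (supZ (cross3 bb.1 bb.2) : ℝ) ≤ 2 * (supZ bb.1 : ℝ) * supZ bb.2 := hR
      _ ≤ 2 * (3 * T) * (3 * T) := by gcongr
      _ = 18 * T ^ 2 := by ring
  -- `|α̂|_∞ > X/(15T)`
  rw [Wab, mem_boxVec_iff] at hW1
  obtain ⟨xy, hxy, heq⟩ := hW1
  rw [mem_box_iff] at hxy
  have hx : X < (mulVec (castVec (aplus bb)) (castVec bb.1)).1 := by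
    rw [← castVec_imulVec, ← heq]; simpa [castVec] using hxy.1
  have ha := exists_abs_coord_alpha_ge (by positivity : (0 : ℝ) < 3 * T) hB1.1 hB1.2.1 hB1.2.2 hx
  have haZ : X / (5 * (3 * T)) < (supZ (aplus bb) : ℝ) := by
    have : ((supZ (aplus bb) : ℤ) : ℝ) = max |((aplus bb).1 : ℝ)| (max |((aplus bb).2.1 : ℝ)| |((aplus bb).2.2 : ℝ)|) := by
      simp only [supZ]; push_cast; rfl
    rw [this]; exact ha
  -- `|v|_∞ = D |α̂|_∞`
  have hvD : (supZ (cross3 bb.1 bb.2) : ℝ) = (Dhcf bb : ℝ) * (supZ (aplus bb) : ℝ) := by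
    have h := congrArg supZ (smul_aplus bb)
    rw [supZ_smul, supZ_rev, abs_of_nonneg (by positivity)] at h
    have : ((supZ (cross3 bb.1 bb.2) : ℤ) : ℝ) = (((Dhcf bb : ℤ) * supZ (aplus bb) : ℤ) : ℝ) := by exact_mod_cast h.symm
    rw [this]; push_cast; ring
  have hD0 : (0 : ℝ) ≤ Dhcf bb := by positivity
  have h15 : 0 < X / (15 * T) := by positivity
  have key : (Dhcf bb : ℝ) * (X / (15 * T)) ≤ 18 * T ^ 2 := by
    calc (Dhcf bb : ℝ) * (X / (15 * T)) ≤ (Dhcf bb : ℝ) * (supZ (aplus bb) : ℝ) := by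
          apply mul_le_mul_of_nonneg_left _ hD0
          rw [show X / (15 * T) = X / (5 * (3 * T)) by ring]; exact haZ.le
      _ = (supZ (cross3 bb.1 bb.2) : ℝ) := hvD.symm
      _ ≤ 18 * T ^ 2 := hv18
  rw [le_div_iff₀ hX]
  have : (Dhcf bb : ℝ) * X ≤ 18 * T ^ 2 * (15 * T) := by
    have := mul_le_mul_of_nonneg_right key (by positivity : (0:ℝ) ≤ 15 * T)
    rwa [mul_assoc, div_mul_cancel₀ _ (by positivity : (15 : ℝ) * T ≠ 0)] at this
  calc (Dhcf bb : ℝ) * X ≤ 18 * T ^ 2 * (15 * T) := this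
    _ = 270 * V := by rw [← hTV]; ring

end Literature.NumberTheory.Sieve.CubicSieve

end
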